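import Mathlib
import HarnessLib
import Literature.MathematicalPhysics.KineticTheory.HardSphereEuler
import Literature.MathematicalPhysics.KineticTheory.BackwardCluster
import Literature.MathematicalPhysics.KineticTheory.HardSphereEulerProofs
import Summits.AtomisticToContinuum.HydrodynamicLimit.Theses.RelayRaceLocality
import Summits.AtomisticToContinuum.HydrodynamicLimit.Theorems.RelayRaceLocalityGibbsLightConeSimpleChainBridge
import Summits.AtomisticToContinuum.HydrodynamicLimit.Theorems.RelayRaceLocalityGibbsLightConeLinkGlueSlab
import Summits.AtomisticToContinuum.HydrodynamicLimit.Theorems.RelayRaceLocalityGibbsLightConeHotGlueSlab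
import Summits.AtomisticToContinuum.HydrodynamicLimit.Theorems.RelayRaceLocalityGibbsLightConeStubPairSlabContact

/-!
# Skeleton of the line `Sketch` (= idea card `log-window-tagged-tail`) for the crux
`RelayRaceLocality.GibbsLightCone` (stmt-AtomisticToContinuum-12501) — REVISION 15 (seat `…-c5-0`)

Revision 15 (seat `…-c5-0`, cycle 5): declarations UNCHANGED from revision 14 (same two `sorry`s, same
composition `GibbsLightCone_of`); re-registered under this seat. New this cycle: the composition below with the
two open stubs turned into explicit hypotheses is landed sorry-free as
`Theorems/RelayRaceLocalityGibbsLightConeOfSeams.lean` (`slabContactNecklaceBound_of_two_le`,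
`gibbsLightCone_of_seams`), so that `GibbsLightCone ⇐ X″(n ≥ 2) ∧ Y″` is a tree theorem and the crux closes
from two item signatures (the registered stub signatures verbatim) with no further Lean. Text of revision 14
follows.

Revision 14 (seat `…-c4-0`, cycle 4): the two first-moment / equal-time ANCHORS of revision 13 are LANDED —
`stub_pairSlabContact` (p133335, `Theorems/RelayRaceLocalityGibbsLightConeStubPairSlabContact.lean`,
now imported: the `n = 1` instance of `X″`, `C = 40√3`, all `σ ≤ 1/2`, all `N, t, Δ`) and the non-composing
`stub_staticNecklaceAnchor` (p133313, `Theorems/RelayRaceLocalityGibbsLightConeStubStaticNecklaceAnchor.lean`: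
equal-time Ruelle necklace `G_N{n consecutive chain labels within r at one time} ≤ (32 r³)ⁿ`, all `n, N`,
`σ < σ₀`). Exactly TWO `sorry`s remain, the multi-time seams `stub_slabContactNecklaceBound_two_le` (X″,
`n ≥ 2`) and `stub_tiltedSlabContactNecklaceBound` (Y″); a worker audit (evidence `X2-report.md`) found X″
NOT misstated and isolated the minimal missing input as the two-slab collision bound `MissingX2` /
its Palm form `MissingX2Palm` (two-time Palm-vs-Gibbs domination), absent from the tree and from print at
fixed reduced density. Text of revision 13 follows.

Revision 11/12 (seat `…-c2-0`, re-registered by this seat) reduced the crux to two seams, both MULTI-TIME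
Ruelle bounds for the deterministic flow under the invariant Gibbs law: `X″` (slab-contact necklace bound,
link sector) and `Y″` (its hot-tilted version, hot sector), through the landed glues
`stub_linkCountTail_of_slabContactNecklaceBound` (p130411) and
`stub_hotPathLengthTail_of_tiltedSlabContactNecklaceBound` (p130554) and the landed bridge
`gibbsLightCone_of_hotPathLengthTail_of_linkCountTail`.

Revision 13 separates, inside `X″`, what the tree CAN prove from what it cannot:

* `stub_pairSlabContact` (ANCHOR, first moment; the instance `n = 1` of `X″`): under `G_N` the probability
  that a prescribed pair is in contact at some time of a slab `[t, t + Δ]` is `≤ C ε_N² √θ Δ`, for EVERY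
  `N`, `t`, `Δ > 0`, `σ ≤ 1/2` — Markov form of the collision-flux bound
  (`measure_collisionSum_ge_le_liminf` with the pair-indicator mark, the one-window event of
  `exists_windowEvent_of_pairBound`, the Ruelle pair constant `posGibbs_pairEvent_le_five`, the Gaussian
  flux integral `lintegral_norm_sub_prod_gaussMeasure_le`, stationarity
  `measurePreserving_flow_localGibbsLaw_const`; Cercignani–Illner–Pulvirenti 1994 App. 4.A).
* `stub_slabContactNecklaceBound_two_le` (OPEN seam `X″` restricted to `2 ≤ n` links, with `0 ≤ C₁`):
  from two links in two slabs on, the bound is a DEcorrelation statement across a time gap (Palm measure of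
  one pair collision versus the Gibbs law on a PAST event), not a first-moment fact; no tree theorem and no
  printed result at fixed reduced density supplies it (Lanford-type expansions reach a fraction of one mean
  free time; the window is `K log N` mean free times). This and `Y″` are the promotion candidates.
* `slabContactNecklaceBound` (`X″` verbatim, the hypothesis of glue L″; formerly `stub_slabContactNecklaceBound`) is now
  PROVED here from the two:
  `n = 0` is `G_N ≤ 1`, `n = 1` is the anchor (`C ε²√θΔ ≤ C (ε + Λ√θΔ)³`), `n ≥ 2` is the open stub.
* `stub_tiltedSlabContactNecklaceBound` (OPEN seam `Y″`, unchanged): already its `n = 0` slice (hot-length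
  tail of ONE tagged particle at a rate `η` fixed before `M`) encodes survival damping
  `P(no collision over path length yℓ_N) ≤ e^{-ηy}`, a dynamical statement; Jensen + stationarity only give
  `exp(η²M²/2)`-type constants. Not split.
* Registered separately (`workitem stub-add`, not composing): `stub_staticNecklaceAnchor`, the EQUAL-TIME
  shadow of `X″` for ALL `n` (Ruelle necklace bound `G_N{consecutive labels within r at one time} ≤ (C r³)ⁿ`,
  iterated insertion bound `posGibbs_le_two_pow_mul_pi` + `pi_subEvent_inter_eq`) — the spatial half of any
  future proof of the open stub; recorded so that only the TIME dimension remains open.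

`GibbsLightCone_of` = landed bridge ∘ (glue H″ ∘ Y″, glue L″ ∘ X″), concluding the crux BY NAME.
Units: `ℓ_N = (N+1)^{-1/3}/σ²`, `τ_N = ℓ_N/√θ`, `ε_N = hsDiameter σ N = σ³ ℓ_N`; constants fixed before `σ`.
-/

namespace Summit.AtomisticToContinuum.HydrodynamicLimit.Theorems.LogWindowTaggedTail

open Literature.MathematicalPhysics.KineticTheory Literature.Analysis.FluidPDE MeasureTheory Filter Set

open scoped ENNReal

-- `stub_pairSlabContact` (ANCHOR, the `n = 1` instance of `X″`) is LANDED: p133335,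
-- `Theorems/RelayRaceLocalityGibbsLightConeStubPairSlabContact.lean` (imported; `C = 40·√3`).

/-- OPEN SEAM `X″` FROM TWO LINKS ON (multi-time Ruelle bound along an injective label chain, hops =
contacts during slabs, `2 ≤ n`, nonnegative constant): see the module docstring. [folklore] -/
theorem stub_slabContactNecklaceBound_two_le :
    ∀ a θ : ℝ, 0 < a → 0 < θ → ∃ σ₀ : ℝ, 0 < σ₀ ∧ ∃ C₁ Λ : ℝ, 0 ≤ C₁ ∧ 1 ≤ Λ ∧ ∀ K : ℝ, 0 < K →
      ∀ σ : ℝ, 0 < σ → σ < σ₀ →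
      ∀ Φ : (N : ℕ) → HardSphereFlow (Torus.geometry (Fin 3)) (hsDiameter σ N) (N + 1),
      ∀ᶠ N : ℕ in atTop, ∀ M : ℝ, 1 ≤ M → M ≤ K * Real.log ((N : ℝ) + 2) →
        ∀ Δ : ℝ, 0 < Δ → Δ ≤ hsDiameter σ N / Real.sqrt θ →
        ∀ (n : ℕ) (q : Fin (n + 1) → Fin (N + 1)) (T : Fin (n + 2) → ℝ), 2 ≤ n →
          Function.Injective q → Monotone T → T 0 = 0 →
          T (Fin.last (n + 1)) = M * (((N + 1 : ℕ) : ℝ) ^ (-(1 / 3 : ℝ)) / σ ^ 2 / Real.sqrt θ) →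
        localGibbsLaw σ (fun _ => a) (fun _ => 0) (fun _ => θ) N (Φ N)
          {z | ∀ m : Fin n, ∃ u ∈ Set.Icc (T (Fin.castSucc (Fin.succ m))) (T (Fin.castSucc (Fin.succ m)) + Δ),
              s(q (Fin.castSucc m), q (Fin.succ m)) ∈
                contactPairSet (Torus.geometry (Fin 3)) (hsDiameter σ N) ((Φ N).flow u z)}
          ≤ ENNReal.ofReal ((C₁ * (hsDiameter σ N + Λ * Real.sqrt θ * Δ) ^ 3) ^ n) := by
  sorry

/-- SLAB-CONTACT NECKLACE BOUND `X″` (all `n`; the hypothesis of glue L″), from the first-moment anchor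
(`n ≤ 1`) and the open seam (`n ≥ 2`): `n = 0` is `G_N ≤ 1`, `n = 1` is `stub_pairSlabContact` with
`C ε²√θΔ ≤ C (ε + Λ√θΔ)³` (`Λ ≥ 1`), `n ≥ 2` is `stub_slabContactNecklaceBound_two_le`; constants
`min(σ₀, 1/2)`, `max(C₁, C)`, `Λ`. [folklore] -/
theorem slabContactNecklaceBound :
    ∀ a θ : ℝ, 0 < a → 0 < θ → ∃ σ₀ : ℝ, 0 < σ₀ ∧ ∃ C₁ Λ : ℝ, 1 ≤ Λ ∧ ∀ K : ℝ, 0 < K →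
      ∀ σ : ℝ, 0 < σ → σ < σ₀ →
      ∀ Φ : (N : ℕ) → HardSphereFlow (Torus.geometry (Fin 3)) (hsDiameter σ N) (N + 1),
      ∀ᶠ N : ℕ in atTop, ∀ M : ℝ, 1 ≤ M → M ≤ K * Real.log ((N : ℝ) + 2) →
        ∀ Δ : ℝ, 0 < Δ → Δ ≤ hsDiameter σ N / Real.sqrt θ →
        ∀ (n : ℕ) (q : Fin (n + 1) → Fin (N + 1)) (T : Fin (n + 2) → ℝ),
          Function.Injective q → Monotone T → T 0 = 0 →
          T (Fin.last (n + 1)) = M * (((N + 1 : ℕ) : ℝ) ^ (-(1 / 3 : ℝ)) / σ ^ 2 / Real.sqrt θ) →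
        localGibbsLaw σ (fun _ => a) (fun _ => 0) (fun _ => θ) N (Φ N)
          {z | ∀ m : Fin n, ∃ u ∈ Set.Icc (T (Fin.castSucc (Fin.succ m))) (T (Fin.castSucc (Fin.succ m)) + Δ),
              s(q (Fin.castSucc m), q (Fin.succ m)) ∈
                contactPairSet (Torus.geometry (Fin 3)) (hsDiameter σ N) ((Φ N).flow u z)}
          ≤ ENNReal.ofReal ((C₁ * (hsDiameter σ N + Λ * Real.sqrt θ * Δ) ^ 3) ^ n) := by
  obtain ⟨C, hC, hpair⟩ := stub_pairSlabContact
  intro a θ ha hθ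
  obtain ⟨σ₀, hσ₀, C₁, Λ, hC₁, hΛ, htwo⟩ := stub_slabContactNecklaceBound_two_le a θ ha hθ
  refine ⟨min σ₀ (1 / 2), lt_min hσ₀ (by norm_num), max C₁ C, Λ, hΛ, ?_⟩
  intro K hK σ hσ hσlt Φ
  have hσ₀' : σ < σ₀ := lt_of_lt_of_le hσlt (min_le_left _ _)
  have hσhalf : σ ≤ 1 / 2 := (lt_of_lt_of_le hσlt (min_le_right _ _)).le
  filter_upwards [htwo K hK σ hσ hσ₀' Φ] with N hN
  intro M hM hMK Δ hΔ hΔε n q T hq hT hT0 hTlast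
  have hε : 0 < hsDiameter σ N := hsDiameter_pos hσ N
  have hB : 0 ≤ hsDiameter σ N + Λ * Real.sqrt θ * Δ := by
    have : 0 ≤ Λ * Real.sqrt θ * Δ := by positivity
    linarith
  rcases n with _ | _ | n
  · -- no link: the event is everything, the bound is `1`
    haveI := isProbabilityMeasure_localGibbsLaw (a₀ := fun _ => a) (θ₀ := fun _ => θ)
      (u₀ := fun _ => (0 : V3)) continuous_const continuous_const continuous_const
      (fun _ => ha) (fun _ => hθ) hσhalf N (Φ N)
    calc localGibbsLaw σ (fun _ => a) (fun _ => 0) (fun _ => θ) N (Φ N) _ ≤ 1 := prob_le_one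
      _ = ENNReal.ofReal ((max C₁ C * (hsDiameter σ N + Λ * Real.sqrt θ * Δ) ^ 3) ^ 0) := by
          rw [pow_zero, ENNReal.ofReal_one]
  · -- one link: the anchor
    have hq01 : q (Fin.castSucc (0 : Fin 1)) ≠ q (Fin.succ (0 : Fin 1)) := by
      intro h
      exact absurd (hq h) (by decide)
    have h1 := hpair a θ ha hθ σ hσ hσhalf N (Φ N) _ _ hq01 (T (Fin.castSucc (Fin.succ (0 : Fin 1)))) Δ hΔ
    calc localGibbsLaw σ (fun _ => a) (fun _ => 0) (fun _ => θ) N (Φ N) _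
        ≤ localGibbsLaw σ (fun _ => a) (fun _ => 0) (fun _ => θ) N (Φ N)
            {z | ∃ u ∈ Set.Icc (T (Fin.castSucc (Fin.succ (0 : Fin 1))))
                (T (Fin.castSucc (Fin.succ (0 : Fin 1))) + Δ),
              s(q (Fin.castSucc (0 : Fin 1)), q (Fin.succ (0 : Fin 1))) ∈
                contactPairSet (Torus.geometry (Fin 3)) (hsDiameter σ N) ((Φ N).flow u z)} :=
          measure_mono fun z hz => by simp only [Set.mem_setOf_eq] at hz ⊢; exact hz 0
      _ ≤ ENNReal.ofReal (C * (hsDiameter σ N ^ 2 * Real.sqrt θ * Δ)) := h1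
      _ ≤ ENNReal.ofReal ((max C₁ C * (hsDiameter σ N + Λ * Real.sqrt θ * Δ) ^ 3) ^ (0 + 1)) := by
          refine ENNReal.ofReal_le_ofReal ?_
          rw [zero_add, pow_one]
          have hx : 0 ≤ Real.sqrt θ * Δ := by positivity
          have hcube : hsDiameter σ N ^ 2 * Real.sqrt θ * Δ ≤
              (hsDiameter σ N + Λ * Real.sqrt θ * Δ) ^ 3 := by
            have h2 : hsDiameter σ N ^ 2 ≤ (hsDiameter σ N + Λ * Real.sqrt θ * Δ) ^ 2 := by
              refine pow_le_pow_left₀ hε.le ?_ 2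
              have : 0 ≤ Λ * Real.sqrt θ * Δ := by positivity
              linarith
            have h3 : Real.sqrt θ * Δ ≤ hsDiameter σ N + Λ * Real.sqrt θ * Δ := by
              have : Real.sqrt θ * Δ ≤ Λ * (Real.sqrt θ * Δ) := le_mul_of_one_le_left hx hΛ
              nlinarith
            calc hsDiameter σ N ^ 2 * Real.sqrt θ * Δ
                = hsDiameter σ N ^ 2 * (Real.sqrt θ * Δ) := by ring
              _ ≤ (hsDiameter σ N + Λ * Real.sqrt θ * Δ) ^ 2 * (hsDiameter σ N + Λ * Real.sqrt θ * Δ) :=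
                  mul_le_mul h2 h3 hx (pow_nonneg hB 2)
              _ = (hsDiameter σ N + Λ * Real.sqrt θ * Δ) ^ 3 := by ring
          calc C * (hsDiameter σ N ^ 2 * Real.sqrt θ * Δ)
              ≤ C * (hsDiameter σ N + Λ * Real.sqrt θ * Δ) ^ 3 := mul_le_mul_of_nonneg_left hcube hC
            _ ≤ max C₁ C * (hsDiameter σ N + Λ * Real.sqrt θ * Δ) ^ 3 :=
                mul_le_mul_of_nonneg_right (le_max_right _ _) (pow_nonneg hB 3)
  · -- two links or more: the open seam
    have hn : 2 ≤ n + 1 + 1 := by omega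
    calc localGibbsLaw σ (fun _ => a) (fun _ => 0) (fun _ => θ) N (Φ N) _
        ≤ ENNReal.ofReal ((C₁ * (hsDiameter σ N + Λ * Real.sqrt θ * Δ) ^ 3) ^ (n + 1 + 1)) :=
          hN M hM hMK Δ hΔ hΔε (n + 1 + 1) q T hn hq hT hT0 hTlast
      _ ≤ ENNReal.ofReal ((max C₁ C * (hsDiameter σ N + Λ * Real.sqrt θ * Δ) ^ 3) ^ (n + 1 + 1)) := by
          refine ENNReal.ofReal_le_ofReal (pow_le_pow_left₀ ?_ ?_ _)
          · exact mul_nonneg hC₁ (pow_nonneg hB 3)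
          · exact mul_le_mul_of_nonneg_right (le_max_left _ _) (pow_nonneg hB 3)

/-- TILTED SLAB-CONTACT NECKLACE BOUND `Y″` (OPEN seam, hot sector): the event of `X″` together with a hot
path length of the carriers above `y ℓ_N` costs an extra `C₂ e^{c₂ M} e^{-η y}`. [folklore] -/
theorem stub_tiltedSlabContactNecklaceBound :
    ∀ a θ : ℝ, 0 < a → 0 < θ → ∃ σ₀ : ℝ, 0 < σ₀ ∧ ∃ A η C₁ Λ c₂ C₂ : ℝ, 0 ≤ A ∧ 0 < η ∧ 1 ≤ Λ ∧
      ∀ K : ℝ, 0 < K →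
      ∀ σ : ℝ, 0 < σ → σ < σ₀ →
      ∀ Φ : (N : ℕ) → HardSphereFlow (Torus.geometry (Fin 3)) (hsDiameter σ N) (N + 1),
      ∀ᶠ N : ℕ in atTop, ∀ M : ℝ, 1 ≤ M → M ≤ K * Real.log ((N : ℝ) + 2) →
        ∀ Δ : ℝ, 0 < Δ → Δ ≤ hsDiameter σ N / Real.sqrt θ →
        ∀ (n : ℕ) (q : Fin (n + 1) → Fin (N + 1)) (T : Fin (n + 2) → ℝ),
          Function.Injective q → Monotone T → T 0 = 0 →
          T (Fin.last (n + 1)) = M * (((N + 1 : ℕ) : ℝ) ^ (-(1 / 3 : ℝ)) / σ ^ 2 / Real.sqrt θ) →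
        ∀ y : ℝ, 0 ≤ y →
        localGibbsLaw σ (fun _ => a) (fun _ => 0) (fun _ => θ) N (Φ N)
          {z | (∀ m : Fin n, ∃ u ∈ Set.Icc (T (Fin.castSucc (Fin.succ m))) (T (Fin.castSucc (Fin.succ m)) + Δ),
              s(q (Fin.castSucc m), q (Fin.succ m)) ∈
                contactPairSet (Torus.geometry (Fin 3)) (hsDiameter σ N) ((Φ N).flow u z)) ∧
              y * (((N + 1 : ℕ) : ℝ) ^ (-(1 / 3 : ℝ)) / σ ^ 2) <
                ∑ m : Fin (n + 1), ∫ u in T (Fin.castSucc m)..(T (Fin.succ m) + Δ),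
                  (if A * Real.sqrt θ < ‖(((Φ N).flow u z) (q m)).2‖ then
                    ‖(((Φ N).flow u z) (q m)).2‖ else 0)}
          ≤ ENNReal.ofReal (C₂ * (C₁ * (hsDiameter σ N + Λ * Real.sqrt θ * Δ) ^ 3) ^ n *
              Real.exp (c₂ * M) * Real.exp (-η * y)) := by
  sorry

/-- `GibbsLightCone` from the two seams through the two glues and the landed two-hypothesis bridge
`gibbsLightCone_of_hotPathLengthTail_of_linkCountTail`. [folklore] -/
theorem GibbsLightCone_of :
    Summit.AtomisticToContinuum.HydrodynamicLimit.Theses.RelayRaceLocality.GibbsLightCone :=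
  gibbsLightCone_of_hotPathLengthTail_of_linkCountTail
    (stub_hotPathLengthTail_of_tiltedSlabContactNecklaceBound stub_tiltedSlabContactNecklaceBound)
    (stub_linkCountTail_of_slabContactNecklaceBound slabContactNecklaceBound)

end Summit.AtomisticToContinuum.HydrodynamicLimit.Theorems.LogWindowTaggedTail
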